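import Literature.Analysis.Hypoelliptic.RegCommute
import HarnessLib

/-!
# The bootstrap: from the subelliptic estimate to the gain of `ε/2` derivatives for `Ĥ^t` data

Analysis/Hypoelliptic support file serving the discharge of
`Literature.Analysis.Distribution.Hormander1967_thm11` by Kohn's method (M. Taylor,
*Pseudodifferential Operators* (1981), Ch. XV §1, (1.26)–(1.28) and "this argument can be
iterated to yield `u ∈ H^{s+ε}_{loc}`", p. 322).

* **Fatou on the Fourier side** (`inH_of_wnorm_reg_mul_le`): a `δ`-uniform bound on
  `‖m_δ F‖_s` gives `F ∈ Ĥ^s`.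
* `FlatHData`: a Hörmander operator with flat coefficients; `Pf`, the identity
  `P (m_δ G) = m_δ (P G) - (remainders)` (`Pf_reg_mul`) and the uniform bound
  `‖P (m_δ G)‖_t ≤ ‖P G‖_t + C (∑_j ‖X_j G‖_t + ‖G‖_t)` (`rn_Pf_reg_mul_le`).
* **The bootstrap step** (`HData.bootstrap_step`): for an `HData` `d` satisfying the spanning
  hypothesis whose action agrees with a flat operator, if `G`, `X_j G`, `P G ∈ Ĥ^t` then
  `G`, `X_j G ∈ Ĥ^{t + ε/2}` (`ε = epsOf`).

## References

* M. E. Taylor, *Pseudodifferential Operators* (1981), Ch. XV §1, (1.26)–(1.28).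
-/

noncomputable section

open MeasureTheory Set Filter Function Module
open scoped ENNReal NNReal Topology ComplexConjugate InnerProductSpace BigOperators

namespace Literature.Analysis.Hypoelliptic

variable {V : Type*} [NormedAddCommGroup V] [InnerProductSpace ℝ V] [FiniteDimensional ℝ V]
  [MeasurableSpace V] [BorelSpace V]

/-! ### Fatou on the Fourier side -/

omit [InnerProductSpace ℝ V] [FiniteDimensional ℝ V] [MeasurableSpace V] [BorelSpace V] in
/-- The squared weighted integrand as `ofReal` of a real square. [folklore] -/
theorem sq_integrand_eq (s : ℝ) (z : ℂ) (ξ : V) :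
    (ENNReal.ofReal (bw s ξ) * ‖z‖ₑ) ^ 2 = ENNReal.ofReal ((bw s ξ * ‖z‖) ^ 2) := by
  rw [← ofReal_norm, ← ENNReal.ofReal_mul (bw_nonneg s ξ),
    ← ENNReal.ofReal_pow (mul_nonneg (bw_nonneg s ξ) (norm_nonneg z))]

/-- **Fatou on the Fourier side**: if `‖m_δ F‖_s ≤ B < ∞` for all `δ > 0` then `F ∈ Ĥ^s` with
`‖F‖_s ≤ B`. [folklore] -/
theorem inH_of_wnorm_reg_mul_le {s : ℝ} {F : V → ℂ} (hF : AEStronglyMeasurable F volume)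
    {B : ℝ≥0∞} (hB : B < ∞) (h : ∀ δ : ℝ, 0 < δ → wnorm s (fun ξ => reg δ ξ * F ξ) ≤ B) :
    InH s F ∧ wnorm s F ≤ B := by
  -- the integrands
  set f : ℝ → V → ℝ≥0∞ := fun δ ξ => (ENNReal.ofReal (bw s ξ) * ‖reg δ ξ * F ξ‖ₑ) ^ 2 with hf
  have hlim : ∀ ξ, Tendsto (fun δ => f δ ξ) (𝓝[>] (0 : ℝ))
      (𝓝 ((ENNReal.ofReal (bw s ξ) * ‖F ξ‖ₑ) ^ 2)) := fun ξ => by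
    simp only [hf, sq_integrand_eq]
    refine (ENNReal.continuous_ofReal.tendsto _).comp ?_
    have h1 : Tendsto (fun δ => reg δ ξ * F ξ) (𝓝[>] (0 : ℝ)) (𝓝 (F ξ)) := by
      have := ((tendsto_reg ξ).mono_left (nhdsWithin_le_nhds (s := Ioi (0 : ℝ)))).mul_const (F ξ)
      rwa [one_mul] at this
    exact ((h1.norm).const_mul (bw s ξ)).pow 2
  have hmeas : ∀ δ, AEMeasurable (f δ) volume := fun δ => by
    have hm : AEStronglyMeasurable (fun ξ => reg δ ξ * F ξ) volume :=
      (Complex.measurable_ofReal.comp ((measurable_regProfile δ).comp (by fun_prop))).aestronglyMeasurable.mul hF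
    exact (((continuous_bw s).measurable.ennreal_ofReal.aemeasurable).mul hm.enorm).pow_const 2
  -- Fatou
  have hfat := lintegral_liminf_le' (μ := volume) (u := 𝓝[>] (0 : ℝ)) hmeas
  have hleft : ∫⁻ ξ, (ENNReal.ofReal (bw s ξ) * ‖F ξ‖ₑ) ^ 2 = ∫⁻ ξ, liminf (fun δ => f δ ξ) (𝓝[>] (0 : ℝ)) :=
    lintegral_congr fun ξ => ((hlim ξ).liminf_eq).symm
  have hright : liminf (fun δ => ∫⁻ ξ, f δ ξ) (𝓝[>] (0 : ℝ)) ≤ B ^ 2 := by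
    refine liminf_le_of_frequently_le' (Eventually.frequently ?_)
    filter_upwards [self_mem_nhdsWithin] with δ hδ
    have := h δ hδ
    rw [← wnorm_sq]
    exact pow_le_pow_left' this 2
  have hsq : wnorm s F ^ 2 ≤ B ^ 2 := by
    rw [wnorm_sq, hleft]; exact hfat.trans hright
  have hle : wnorm s F ≤ B := (ENNReal.pow_le_pow_left_iff two_ne_zero).1 hsq
  exact ⟨⟨hF, hle.trans_lt hB⟩, hle⟩

/-- Real-norm version: a uniform bound `rn s (m_δ F) ≤ B` with `m_δ F ∈ Ĥ^s` gives `F ∈ Ĥ^s`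
and `‖F‖_s ≤ B`. [folklore] -/
theorem inH_of_rn_reg_mul_le {s : ℝ} {F : V → ℂ} (hF : AEStronglyMeasurable F volume) {B : ℝ}
    (h : ∀ δ : ℝ, 0 < δ → δ ≤ 1 → InH s (fun ξ => reg δ ξ * F ξ) ∧ rn s (fun ξ => reg δ ξ * F ξ) ≤ B) :
    InH s F ∧ rn s F ≤ B := by
  have hB0 : 0 ≤ B := (rn_nonneg _ _).trans (h 1 one_pos le_rfl).2
  have key : ∀ δ : ℝ, 0 < δ → wnorm s (fun ξ => reg δ ξ * F ξ) ≤ ENNReal.ofReal B := by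
    intro δ hδ
    -- reduce to `δ ≤ 1` using `m_δ = m_{δ - 1 + 1}`: for `δ > 1`, `m_δ F = m_{δ-1} (m_1 F)`… simpler:
    -- `‖m_δ F‖ ≤ ‖m_{min δ 1} F‖` pointwise since `m_δ ≤ m_{δ'}` for `δ' ≤ δ`.
    have hmin : 0 < min δ 1 := lt_min hδ one_pos
    obtain ⟨hI, hr⟩ := h (min δ 1) hmin (min_le_right _ _)
    have hpt : ∀ ξ, ‖reg δ ξ * F ξ‖ₑ ≤ ‖reg (min δ 1) ξ * F ξ‖ₑ := fun ξ => by
      rw [enorm_mul, enorm_mul]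
      refine mul_le_mul' ?_ le_rfl
      rw [← ofReal_norm, ← ofReal_norm, norm_reg, norm_reg]
      refine ENNReal.ofReal_le_ofReal (Real.exp_le_exp.2 ?_)
      have := bw_nonneg 1 ξ
      nlinarith [min_le_left δ 1]
    calc wnorm s (fun ξ => reg δ ξ * F ξ) ≤ wnorm s (fun ξ => reg (min δ 1) ξ * F ξ) :=
          wnorm_le_of_enorm_le hpt
      _ = ENNReal.ofReal (rn s (fun ξ => reg (min δ 1) ξ * F ξ)) := by
          unfold rn; rw [ENNReal.ofReal_toReal hI.2.ne]
      _ ≤ ENNReal.ofReal B := ENNReal.ofReal_le_ofReal hr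
  obtain ⟨hI, hle⟩ := inH_of_wnorm_reg_mul_le hF ENNReal.ofReal_lt_top key
  refine ⟨hI, ?_⟩
  unfold rn
  have := ENNReal.toReal_mono ENNReal.ofReal_ne_top hle
  rwa [ENNReal.toReal_ofReal hB0] at this

/-! ### Hörmander operators with flat coefficients -/

variable (V) in
/-- **A Hörmander operator with flat coefficients** on the Fourier side: flat fields `X_j`
(`j : Fin J`), `X₀` over the standard basis, and a flat zeroth-order coefficient `c + 𝓕a`.
[folklore] -/
structure FlatHData (J : ℕ) where
  /-- the fields `X_j` [folklore] -/
  X : Fin J → FlatField V (Fin (finrank ℝ V))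
  /-- the drift `X₀` [folklore] -/
  X0 : FlatField V (Fin (finrank ℝ V))
  /-- constant part of `c` [folklore] -/
  cC : ℂ
  /-- `𝓕` of the variable part of `c` [folklore] -/
  θC : V → ℂ
  /-- its decay constants [folklore] -/
  DC : ℕ → ℝ
  decayC : RapidDecay θC DC

namespace FlatHData

variable {J : ℕ} (fd : FlatHData V J)

/-- The standard basis as a function. [folklore] -/
def bas : Fin (finrank ℝ V) → V := fun k => stdOrthonormalBasis ℝ V k

/-- The action of `X_j`. [folklore] -/
def Xf (j : Fin J) (G : V → ℂ) : V → ℂ := (fd.X j).applyF bas G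

/-- The action of `X₀`. [folklore] -/
def X0f (G : V → ℂ) : V → ℂ := fd.X0.applyF bas G

/-- The action of `c`. [folklore] -/
def Cf (G : V → ℂ) : V → ℂ := fun ξ => fd.cC * G ξ + kerOp (convKer fd.θC) G ξ

/-- **The action of `P = ∑ X_j² + X₀ + c`.** [folklore] -/
def Pf (G : V → ℂ) : V → ℂ :=
  fun ξ => (∑ j, fd.Xf j (fd.Xf j G) ξ) + fd.X0f G ξ + fd.Cf G ξ

/-- The commutator kernel of `c` with `m_δ`. [folklore] -/
def KrC (δ : ℝ) : V → V → ℂ := commConvKer (reg δ) fd.θC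

/-- **The total remainder**: `P (m_δ G) = m_δ P G - Rtot_δ G`. [folklore] -/
def Rtot (δ : ℝ) (G : V → ℂ) : V → ℂ := fun ξ =>
  (∑ j, (2 * (fd.X j).RF bas δ (fd.Xf j G) ξ + (fd.X j).QF bas δ G ξ)) +
    fd.X0.RF bas δ G ξ + kerOp (fd.KrC δ) G ξ

/-- **Commuting the regulariser past `P`**: `P (m_δ G) = m_δ (P G) - Rtot_δ G` for `G ∈ Ĥ^t`
with `X_j G ∈ Ĥ^t`. [folklore] -/
theorem Pf_reg_mul {δ : ℝ} (hδ : 0 ≤ δ) {t : ℝ} {G : V → ℂ} (hG : InH t G)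
    (hXG : ∀ j, InH t (fd.Xf j G)) :
    fd.Pf (fun ξ => reg δ ξ * G ξ) = fun ξ => reg δ ξ * fd.Pf G ξ - fd.Rtot δ G ξ := by
  ext ξ
  -- the fields
  have hXj : ∀ j, fd.Xf j (fd.Xf j (fun ξ => reg δ ξ * G ξ)) ξ =
      reg δ ξ * fd.Xf j (fd.Xf j G) ξ - (2 * (fd.X j).RF bas δ (fd.Xf j G) ξ + (fd.X j).QF bas δ G ξ) := by
    intro j
    unfold Xf
    rw [(fd.X j).applyF_reg_mul bas hδ hG]
    have hm : InH t (fun ξ => reg δ ξ * (fd.X j).applyF bas G ξ) := by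
      have := (mulBound_reg (V := V) hδ).inH_mul (hXG j); rwa [sub_zero] at this
    have hR : InH t ((fd.X j).RF bas δ G) := (fd.X j).inH_RF bas hδ hG
    rw [(fd.X j).applyF_sub bas hm hR]
    change (fd.X j).applyF bas (fun ξ => reg δ ξ * fd.Xf j G ξ) ξ - (fd.X j).applyF bas ((fd.X j).RF bas δ G) ξ = _
    rw [(fd.X j).applyF_reg_mul bas hδ (hXG j), (fd.X j).applyF_RF bas hδ hG]
    unfold Xf
    simp only
    ring
  have hX0 : fd.X0f (fun ξ => reg δ ξ * G ξ) ξ = reg δ ξ * fd.X0f G ξ - fd.X0.RF bas δ G ξ := by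
    unfold X0f; rw [fd.X0.applyF_reg_mul bas hδ hG]
  have hC : fd.Cf (fun ξ => reg δ ξ * G ξ) ξ = reg δ ξ * fd.Cf G ξ - kerOp (fd.KrC δ) G ξ := by
    unfold Cf KrC
    have h := congrFun (fd.decayC.kerDecay_convKer.comm_mul_kerOp (mulBound_reg hδ) hG) ξ
    try simp only at h
    rw [commConvKer_eq]
    linear_combination -h
  unfold Pf Rtot
  rw [Finset.sum_congr rfl fun j _ => hXj j, hX0, hC, Finset.sum_sub_distrib, ← Finset.mul_sum,
    mul_add, mul_add]
  ring

/-- **The uniform bound of the remainder**: `‖Rtot_δ G‖_t ≤ C (∑_j ‖X_j G‖_t + ‖G‖_t)`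
with `C` independent of `δ ≥ 0`. [folklore] -/
theorem rn_Rtot_le (t : ℝ) : ∃ C : ℝ, 0 ≤ C ∧ ∀ {δ : ℝ}, 0 ≤ δ → ∀ {G : V → ℂ}, InH t G →
    (∀ j, InH t (fd.Xf j G)) →
      InH t (fd.Rtot δ G) ∧ rn t (fd.Rtot δ G) ≤ C * ((∑ j, rn t (fd.Xf j G)) + rn t G) := by
  choose CQ hCQ0 hQ using fun j => (fd.X j).rn_QF_le bas t
  have hKC : ∀ {δ : ℝ}, 0 ≤ δ → KerDecay (fd.KrC δ) (-1) (fun N => FlatField.dreg * fd.DC (N + ⌈FlatField.Mreg⌉₊)) :=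
    fun hδ => (mulDiff_reg hδ).kerDecay_commConvKer fd.decayC
  set cC : ℝ := schurConst V (t + 1) (fun N => FlatField.dreg * fd.DC (N + ⌈FlatField.Mreg⌉₊)) with hcC
  have hcC0 : 0 ≤ cC := schurConst_nonneg (fun N => mul_nonneg FlatField.dreg_nonneg (fd.decayC.nonneg _)) _
  have hS0 : 0 ≤ ∑ j, (2 * (fd.X j).CR bas t + CQ j) := Finset.sum_nonneg fun j _ =>
    add_nonneg (mul_nonneg zero_le_two ((fd.X j).CR_nonneg bas t)) (hCQ0 j)
  set M : ℝ := (∑ j, (2 * (fd.X j).CR bas t + CQ j)) + fd.X0.CR bas t + cC with hM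
  have hM0 : 0 ≤ M := by have := fd.X0.CR_nonneg bas t; positivity
  refine ⟨M, hM0, fun {δ} hδ {G} hG hXG => ?_⟩
  -- the pieces
  have hR : ∀ j, InH t ((fd.X j).RF bas δ (fd.Xf j G)) ∧
      rn t ((fd.X j).RF bas δ (fd.Xf j G)) ≤ (fd.X j).CR bas t * rn t (fd.Xf j G) := fun j =>
    ⟨(fd.X j).inH_RF bas hδ (hXG j), (fd.X j).rn_RF_le bas hδ t (hXG j)⟩
  have hQ' : ∀ j, InH t ((fd.X j).QF bas δ G) ∧ rn t ((fd.X j).QF bas δ G) ≤ CQ j * rn t G :=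
    fun j => hQ j hδ hG
  have hR0 : InH t (fd.X0.RF bas δ G) ∧ rn t (fd.X0.RF bas δ G) ≤ fd.X0.CR bas t * rn t G :=
    ⟨fd.X0.inH_RF bas hδ hG, fd.X0.rn_RF_le bas hδ t hG⟩
  have hKG : InH t (kerOp (fd.KrC δ) G) ∧ rn t (kerOp (fd.KrC δ) G) ≤ cC * rn t G := by
    have h := (hKC hδ).inH_kerOp hG
    have h' := (hKC hδ).rn_kerOp_le t hG
    rw [show t - (-1 : ℝ) = t + 1 by ring] at h h'
    refine ⟨h.mono (by linarith), ?_⟩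
    have hm : rn t (kerOp (fd.KrC δ) G) ≤ rn (t + 1) (kerOp (fd.KrC δ) G) := by
      unfold rn
      exact ENNReal.toReal_mono h.2.ne (wnorm_mono (by linarith) _)
    exact hm.trans h'
  -- the field terms
  set xs : ℝ := ∑ j, rn t (fd.Xf j G) with hxs
  have hxs0 : 0 ≤ xs := Finset.sum_nonneg fun j _ => rn_nonneg _ _
  have hn0 := rn_nonneg t G
  have hxj : ∀ j, rn t (fd.Xf j G) ≤ xs := fun j =>
    Finset.single_le_sum (f := fun j => rn t (fd.Xf j G)) (fun _ _ => rn_nonneg _ _) (Finset.mem_univ j)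
  have hterm : ∀ j, InH t (fun ξ => 2 * (fd.X j).RF bas δ (fd.Xf j G) ξ + (fd.X j).QF bas δ G ξ) ∧
      rn t (fun ξ => 2 * (fd.X j).RF bas δ (fd.Xf j G) ξ + (fd.X j).QF bas δ G ξ) ≤
        (2 * (fd.X j).CR bas t + CQ j) * (xs + rn t G) := fun j => by
    obtain ⟨i1, b1⟩ := hR j
    obtain ⟨i2, b2⟩ := hQ' j
    refine ⟨(i1.const_mul 2).add i2, ((i1.const_mul 2).rn_add_le i2).trans ?_⟩
    rw [rn_const_mul, show ‖(2 : ℂ)‖ = 2 by simp]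
    have := (fd.X j).CR_nonneg bas t; have := hCQ0 j; have := rn_nonneg t ((fd.X j).RF bas δ (fd.Xf j G))
    nlinarith only [b1, b2, hxj j, this, hCQ0 j, (fd.X j).CR_nonneg bas t, hxs0, hn0,
      mul_le_mul_of_nonneg_left (hxj j) ((fd.X j).CR_nonneg bas t)]
  have hsumI : InH t (fun ξ => ∑ j, (2 * (fd.X j).RF bas δ (fd.Xf j G) ξ + (fd.X j).QF bas δ G ξ)) :=
    InH.finset_sum _ fun j => (hterm j).1
  have hsumB : rn t (fun ξ => ∑ j, (2 * (fd.X j).RF bas δ (fd.Xf j G) ξ + (fd.X j).QF bas δ G ξ)) ≤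
      (∑ j, (2 * (fd.X j).CR bas t + CQ j)) * (xs + rn t G) := by
    refine (InH.rn_finset_sum_le _ fun j => (hterm j).1).trans ?_
    rw [Finset.sum_mul]
    exact Finset.sum_le_sum fun j _ => (hterm j).2
  unfold Rtot
  refine ⟨(hsumI.add hR0.1).add hKG.1, (((hsumI.add hR0.1).rn_add_le hKG.1).trans
    ((add_le_add (hsumI.rn_add_le hR0.1) le_rfl).trans ?_))⟩
  rw [hM]
  nlinarith only [hsumB, hR0.2, hKG.2, hxs0, hn0, fd.X0.CR_nonneg bas t, hcC0, hS0]

end FlatHData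

/-! ### The bootstrap step -/

namespace HData

open Sym Field

/-- **The bootstrap step** (Taylor p. 322): let `d` satisfy the spanning hypothesis (gain
`ε = epsOf L`) and act as a flat operator `fd`. If `G, X_j G, P G ∈ Ĥ^t` then
`G ∈ Ĥ^{t+ε}` and `X_j G ∈ Ĥ^{t+ε/2}`. [folklore] -/
theorem bootstrap_step (d : HData V) {L : Fin (finrank ℝ V) → List (Sym V × BWord d.J)}
    (hL : d.SpanHyp L) (fd : FlatHData V d.J)
    (hP : ∀ G, d.opP.apply G = fd.Pf G) (hX : ∀ j G, (d.Xs j).apply G = fd.Xf j G)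
    {t : ℝ} {G : V → ℂ} (hG : InH t G) (hXG : ∀ j, InH t (fd.Xf j G)) (hPG : InH t (fd.Pf G)) :
    InH (t + d.epsOf L) G ∧ ∀ j, InH (t + d.epsOf L / 2) (fd.Xf j G) := by
  set ε := d.epsOf L with hε
  have hε0 : 0 < ε := d.epsOf_pos L
  obtain ⟨C, hC0, hC⟩ := d.apriori hL t
  obtain ⟨CR, hCR0, hRt⟩ := fd.rn_Rtot_le t
  set xs : ℝ := ∑ j, rn t (fd.Xf j G) with hxs
  set B : ℝ := C * (rn t (fd.Pf G) + CR * (xs + rn t G) + rn t G) with hB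
  -- the uniform bound for the regularised functions
  have key : ∀ δ : ℝ, 0 < δ → δ ≤ 1 →
      Nice (fun ξ => reg δ ξ * G ξ) ∧
      rn (t + ε) (fun ξ => reg δ ξ * G ξ) +
        ∑ j, rn (t + ε / 2) ((d.Xs j).apply (fun ξ => reg δ ξ * G ξ)) ≤ B := by
    intro δ hδ _
    have hv : Nice (fun ξ => reg δ ξ * G ξ) := nice_reg_mul hδ hG
    refine ⟨hv, (hC _ hv).trans ?_⟩
    -- `‖v‖_t ≤ ‖G‖_t`
    have h1 : rn t (fun ξ => reg δ ξ * G ξ) ≤ rn t G := by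
      unfold rn; exact ENNReal.toReal_mono hG.2.ne (wnorm_reg_mul_le hδ.le t G)
    -- `‖P v‖_t ≤ ‖P G‖_t + ‖Rtot G‖_t`
    obtain ⟨hRI, hRb⟩ := hRt hδ.le hG hXG
    have hmP : InH t (fun ξ => reg δ ξ * fd.Pf G ξ) := by
      have := (mulBound_reg (V := V) hδ.le).inH_mul hPG; rwa [sub_zero] at this
    have h2 : rn t (d.opP.apply (fun ξ => reg δ ξ * G ξ)) ≤ rn t (fd.Pf G) + CR * (xs + rn t G) := by
      rw [hP, fd.Pf_reg_mul hδ.le hG hXG]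
      refine (hmP.rn_sub_le hRI).trans (add_le_add ?_ hRb)
      unfold rn; exact ENNReal.toReal_mono hPG.2.ne (wnorm_reg_mul_le hδ.le t _)
    rw [hB]
    have := rn_nonneg t (fd.Pf G)
    nlinarith only [h1, h2, hC0, mul_le_mul_of_nonneg_left (add_le_add h2 h1) hC0]
  -- `G ∈ Ĥ^{t+ε}`
  have hGε : InH (t + ε) G ∧ rn (t + ε) G ≤ B := by
    refine inH_of_rn_reg_mul_le hG.1 fun δ hδ hδ1 => ?_
    obtain ⟨hv, hb⟩ := key δ hδ hδ1
    have hs0 : 0 ≤ ∑ j, rn (t + ε / 2) ((d.Xs j).apply (fun ξ => reg δ ξ * G ξ)) :=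
      Finset.sum_nonneg fun _ _ => rn_nonneg _ _
    exact ⟨hv.inH _, by linarith⟩
  have hGε2 : InH (t + ε / 2) G := hGε.1.mono (by linarith)
  refine ⟨hGε.1, fun j => ?_⟩
  -- `X_j G ∈ Ĥ^{t+ε/2}`: `m_δ X_j G = X_j (m_δ G) + R_j G`
  have hXm : (fd.Xf j G) = fd.Xf j G := rfl
  refine (inH_of_rn_reg_mul_le (hXG j).1 (B := B + (fd.X j).CR FlatHData.bas (t + ε / 2) * rn (t + ε / 2) G)
    fun δ hδ hδ1 => ?_).1
  obtain ⟨hv, hb⟩ := key δ hδ hδ1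
  have hid : (fun ξ => reg δ ξ * fd.Xf j G ξ) = fun ξ =>
      (d.Xs j).apply (fun ξ => reg δ ξ * G ξ) ξ + (fd.X j).RF FlatHData.bas δ G ξ := by
    rw [hX]
    unfold FlatHData.Xf
    rw [(fd.X j).applyF_reg_mul FlatHData.bas hδ.le hG]
    ext ξ; ring
  have hXv : Nice ((d.Xs j).apply (fun ξ => reg δ ξ * G ξ)) := (d.cert_Xs j).nice_apply hv
  have hRj : InH (t + ε / 2) ((fd.X j).RF FlatHData.bas δ G) := (fd.X j).inH_RF FlatHData.bas hδ.le hGε2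
  have hRjb := (fd.X j).rn_RF_le FlatHData.bas hδ.le (t + ε / 2) hGε2
  rw [hid]
  refine ⟨(hXv.inH _).add hRj, ((hXv.inH _).rn_add_le hRj).trans (add_le_add ?_ hRjb)⟩
  have hs : rn (t + ε / 2) ((d.Xs j).apply (fun ξ => reg δ ξ * G ξ)) ≤
      ∑ i, rn (t + ε / 2) ((d.Xs i).apply (fun ξ => reg δ ξ * G ξ)) :=
    Finset.single_le_sum (f := fun i => rn (t + ε / 2) ((d.Xs i).apply (fun ξ => reg δ ξ * G ξ)))
      (fun _ _ => rn_nonneg _ _) (Finset.mem_univ j)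
  have := rn_nonneg (t + ε) (fun ξ => reg δ ξ * G ξ)
  linarith

end HData

end Literature.Analysis.Hypoelliptic
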